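import Literature.Analysis.FluidPDE.ClassicalSuitable
import Literature.Analysis.FluidPDE.SpaceTimeCalculus
import HarnessLib

/-!
# The local energy identity of a classical solution against a spatial cut-off, integrated in time

Analysis/FluidPDE proofs file (theorems only; no definitions, no named facts) on the discharge
path of the named fact `Literature.Analysis.FluidPDE.chaeWolf2017_dss_typeI_decay`
(`ChaeWolfRemovingDSS.lean`; D. Chae, J. Wolf, arXiv:1610.09464, Thm. 1.1). Step 2 of the
printed proof ("Local energy inequality", arXiv p. 5, (2.4f)) reads: "Since `u ∈ C^∞(Q)` we get
for all `ϕ ∈ C_c^∞(B(0,R) × (−R², 0])` and for all `t ∈ (−R², −r²)` the following local energy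
equality
`½∫|u(t)|²ϕ² + ∫_{−R²}^t ∫ |∇u|²ϕ² = ½∫∫ |u|²(∂ₜ + Δ)ϕ² + ½∫∫ |u|² u·∇ϕ² + ∫∫ π u·∇ϕ²`".
This file proves that identity for a classical solution of the unforced Navier–Stokes system
on an **open** time set `S` (nothing is assumed at the boundary times of `S`, where the solution
may blow up) and a **time-independent** cut-off `φ ∈ C_c^∞(E)`, between any two times
`t₀ ≤ t₁` with `[t₀, t₁] ⊆ S`:

* `IsClassicalNSSolutionOn.hasDerivAt_integral_cutoff_norm_sq` —
  `d/dt ∫ φ |u(t)|² = ∫ φ · 2⟪u, ∂ₜu⟫` (differentiation under the integral sign for jointly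
  smooth fields against a compactly supported weight, `hasDerivAt_integral_of_support_subset`);
* `IsClassicalNSSolutionOn.integral_energy_flux_cutoff` — the slice balance
  `∫ (νΔφ |u|² + Dφ(u)|u|² + 2 p Dφ(u)) = ∫ φ · 2⟪u, ∂ₜu⟫ + 2ν ∫ |∇u|² φ` at every `t ∈ S`
  (the tree's `integral_energy_flux_eq_of_momentum`, `ClassicalSuitable.lean`, with `f = 0`);
* `IsClassicalNSSolutionOn.local_energy_identity_cutoff` — **the integrated identity**
  `∫ φ|u(t₁)|² − ∫ φ|u(t₀)|² + 2ν ∫_{t₀}^{t₁}∫ |∇u|²φ = ∫_{t₀}^{t₁}∫ (νΔφ|u|² + Dφ(u)|u|² + 2pDφ(u))`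
  (fundamental theorem of calculus in `t`; all time integrands are continuous on `S`).

With `φ = ϕ²` this is (2.4f) for a time-independent `ϕ` (`∇ϕ² = 2ϕ∇ϕ`, `u·∇ψ = Dψ(u)`).

## References

* D. Chae, J. Wolf, arXiv:1610.09464, §2 Step 2, (2.4f) (p. 5). [ChaeWolf2017RemovingDSS]
* L. Caffarelli, R. Kohn, L. Nirenberg, CPAM 35 (1982), §2, (2.5) with equality for smooth `u`.
  [CaffarelliKohnNirenberg1982]
-/

noncomputable section

open MeasureTheory TopologicalSpace Set Function Filter Metric
open _root_.Topology
open scoped Laplacian InnerProductSpace RealInnerProductSpace ENNReal NNReal ContDiff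

namespace Literature.Analysis.FluidPDE

variable {E : Type*} [NormedAddCommGroup E] [InnerProductSpace ℝ E] [FiniteDimensional ℝ E]
  [MeasurableSpace E] [BorelSpace E]

variable {S : Set ℝ} {ν : ℝ} {f u : ℝ → E → E} {p : ℝ → E → ℝ}

/-! ### Differentiating `∫ φ |u(t)|²` in time -/

/-- **`d/dt ∫ φ |u(t)|² = ∫ φ · 2⟪u(t), ∂ₜu(t)⟫`** for a classical solution on an open time set
`S` and a smooth compactly supported weight `φ` (any force). [folklore] -/
theorem IsClassicalNSSolutionOn.hasDerivAt_integral_cutoff_norm_sq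
    (h : IsClassicalNSSolutionOn S ν f u p) (hS : IsOpen S) {φ : E → ℝ} (hφ : ContDiff ℝ ∞ φ)
    (hφc : HasCompactSupport φ) {t : ℝ} (ht : t ∈ S) :
    HasDerivAt (fun s => ∫ x, φ x * ‖u s x‖ ^ 2)
      (∫ x, φ x * (2 * ⟪u t x, timeDerivWithin S u t x⟫)) t := by
  -- the smooth space–time integrand `Φ(s, x) = φ(x) ⟪u, u⟫`
  have hΦ : IsSmoothSpaceTimeOn S fun s x => φ x * ⟪u s x, u s x⟫ :=
    (isSmoothSpaceTimeOn_const_time hφ S).mul (h.smooth_velocity.inner h.smooth_velocity)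
  have hsupp : ∀ s ∈ S, ∀ x ∉ tsupport φ, φ x * ⟪u s x, u s x⟫ = 0 := fun s _ x hx => by
    rw [image_eq_zero_of_notMem_tsupport hx, zero_mul]
  have hD := hasDerivAt_integral_of_support_subset (μ := volume) hS hΦ hφc hsupp ht
  have e1 : (fun s => ∫ x, φ x * ⟪u s x, u s x⟫) = fun s => ∫ x, φ x * ‖u s x‖ ^ 2 := by
    funext s
    refine integral_congr_ae (Eventually.of_forall fun x => ?_)
    simp only [real_inner_self_eq_norm_sq]
  have e2 : ∫ x, deriv (fun s => φ x * ⟪u s x, u s x⟫) t =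
      ∫ x, φ x * (2 * ⟪u t x, timeDerivWithin S u t x⟫) := by
    refine integral_congr_ae (Eventually.of_forall fun x => ?_)
    have hl : HasDerivAt (fun s => u s x) (deriv (fun s => u s x) t) t :=
      h.smooth_velocity.hasDerivAt_timeLine hS ht x
    have h2 := ((hl.inner ℝ hl).const_mul (φ x)).deriv
    show deriv (fun s => φ x * ⟪u s x, u s x⟫) t = φ x * (2 * ⟪u t x, timeDerivWithin S u t x⟫)
    rw [h2, timeDerivWithin_eq_deriv_of_mem_nhds (hS.mem_nhds ht) u x, real_inner_comm]
    ring
  rw [e1, e2] at hD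
  exact hD

/-- The time-derivative pairing `s ↦ ∫ φ · 2⟪u(s), ∂ₜu(s)⟫` is continuous on `S`. [folklore] -/
theorem IsClassicalNSSolutionOn.continuousOn_integral_cutoff_inner_timeDeriv
    (h : IsClassicalNSSolutionOn S ν f u p) (hS : IsOpen S) {φ : E → ℝ} (hφ : Continuous φ)
    (hφc : HasCompactSupport φ) :
    ContinuousOn (fun s => ∫ x, φ x * (2 * ⟪u s x, timeDerivWithin S u s x⟫)) S := by
  refine continuousOn_integral_of_support_subset (μ := volume) (K := tsupport φ) hφc ?_ ?_
  · have h1 := h.smooth_velocity.continuousOn_timeDerivWithin hS.uniqueDiffOn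
    have h2 := h.smooth_velocity.continuousOn
    have h3 : ContinuousOn (fun z : ℝ × E => φ z.2) (S ×ˢ univ) := (hφ.comp continuous_snd).continuousOn
    exact h3.mul (continuousOn_const.mul (h2.inner h1))
  · intro s _ x hx
    show φ x * (2 * ⟪u s x, timeDerivWithin S u s x⟫) = 0
    rw [image_eq_zero_of_notMem_tsupport hx, zero_mul]

/-! ### The slice balance -/

/-- **The local energy balance at a fixed time** (CKN (2.5) with equality, unforced):
`∫ (νΔφ |u|² + Dφ(u) |u|² + 2 p Dφ(u)) = ∫ φ · 2⟪u, ∂ₜu⟫ + 2ν ∫ |∇u|² φ` for a classical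
solution of the unforced system on an open time set `S`, `t ∈ S`, `φ ∈ C_c^∞`. [cite: CaffarelliKohnNirenberg1982, §2 (2.5)] -/
theorem IsClassicalNSSolutionOn.integral_energy_flux_cutoff
    (h : IsClassicalNSSolutionOn S ν 0 u p) (hS : IsOpen S) {φ : E → ℝ} (hφ : ContDiff ℝ ∞ φ)
    (hφc : HasCompactSupport φ) {t : ℝ} (ht : t ∈ S) :
    ∫ x, (ν * ((Δ φ) x * ‖u t x‖ ^ 2) + fderiv ℝ φ x (u t x) * ‖u t x‖ ^ 2 +
        2 * (p t x * fderiv ℝ φ x (u t x))) =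
      (∫ x, φ x * (2 * ⟪u t x, timeDerivWithin S u t x⟫)) +
        2 * ν * ∫ x, frobeniusNormSq (fderiv ℝ (u t) x) * φ x := by
  have hu2 : ContDiff ℝ 2 (u t) := (h.contDiff_velocity ht).of_le (by norm_cast)
  have hp1 : ContDiff ℝ 1 (p t) := (h.contDiff_pressure ht).of_le (by norm_cast)
  have hdt : Continuous (timeDerivWithin S u t) :=
    ((h.smooth_velocity.timeDerivWithin hS.uniqueDiffOn).contDiff_slice ht).continuous
  have hφ2 : ContDiff ℝ 2 φ := hφ.of_le (by norm_cast)
  have key := integral_energy_flux_eq_of_momentum (f := fun _ : E => (0 : E)) hu2 hp1 hdt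
    continuous_const (fun x => by simpa using h.momentum t ht x) (h.divFree t ht) hφ2 hφc
  have e1 : ∫ x, (ν * ((Δ φ) x * ‖u t x‖ ^ 2) + fderiv ℝ φ x (u t x) * ‖u t x‖ ^ 2 +
      2 * (p t x * fderiv ℝ φ x (u t x)) + 2 * (φ x * ⟪(fun _ : E => (0 : E)) x, u t x⟫)) =
      ∫ x, (ν * ((Δ φ) x * ‖u t x‖ ^ 2) + fderiv ℝ φ x (u t x) * ‖u t x‖ ^ 2 +
        2 * (p t x * fderiv ℝ φ x (u t x))) :=
    integral_congr_ae (Eventually.of_forall fun x => by simp)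
  rw [← e1, key]

/-- The flux `s ↦ ∫ (νΔφ |u(s)|² + Dφ(u)|u|² + 2 p Dφ(u))` is continuous on `S`. [folklore] -/
theorem IsClassicalNSSolutionOn.continuousOn_integral_flux_cutoff
    (h : IsClassicalNSSolutionOn S ν f u p) {φ : E → ℝ} (hφ : ContDiff ℝ ∞ φ)
    (hφc : HasCompactSupport φ) :
    ContinuousOn (fun s => ∫ x, (ν * ((Δ φ) x * ‖u s x‖ ^ 2) +
      fderiv ℝ φ x (u s x) * ‖u s x‖ ^ 2 + 2 * (p s x * fderiv ℝ φ x (u s x)))) S := by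
  have hφ2 : ContDiff ℝ 2 φ := hφ.of_le (by norm_cast)
  have hφ1 : ContDiff ℝ 1 φ := hφ.of_le (by norm_cast)
  have hΔφ : Continuous (Δ φ) := FluidPDE.continuous_laplacian hφ2
  have hDφ : Continuous (fderiv ℝ φ) := hφ1.continuous_fderiv one_ne_zero
  -- the support of all terms lies in `tsupport φ`
  have hsub1 : ∀ x ∉ tsupport φ, (Δ φ) x = 0 := fun x hx =>
    FluidPDE.laplacian_eq_zero_of_notMem_tsupport hx
  have hsub2 : ∀ x ∉ tsupport φ, fderiv ℝ φ x = 0 := fun x hx =>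
    fderiv_of_notMem_tsupport ℝ hx
  refine continuousOn_integral_of_support_subset (μ := volume) (K := tsupport φ) hφc ?_ ?_
  · have cu := h.smooth_velocity.continuousOn
    have cp := h.smooth_pressure.continuousOn
    have c1 : ContinuousOn (fun z : ℝ × E => (Δ φ) z.2) (S ×ˢ univ) :=
      (hΔφ.comp continuous_snd).continuousOn
    have c2 : ContinuousOn (fun z : ℝ × E => fderiv ℝ φ z.2 (u z.1 z.2)) (S ×ˢ univ) :=
      ((hDφ.comp continuous_snd).continuousOn).clm_apply cu
    have c3 : ContinuousOn (fun z : ℝ × E => ‖u z.1 z.2‖ ^ 2) (S ×ˢ univ) := cu.norm.pow 2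
    exact ((continuousOn_const.mul (c1.mul c3)).add (c2.mul c3)).add
      (continuousOn_const.mul (cp.mul c2))
  · intro s _ x hx
    show ν * ((Δ φ) x * ‖u s x‖ ^ 2) + fderiv ℝ φ x (u s x) * ‖u s x‖ ^ 2 +
      2 * (p s x * fderiv ℝ φ x (u s x)) = 0
    rw [hsub1 x hx, hsub2 x hx]
    simp

/-- The localised dissipation `s ↦ ∫ |∇u(s)|² φ` is continuous on `S`. [folklore] -/
theorem IsClassicalNSSolutionOn.continuousOn_integral_dissipation_cutoff
    (h : IsClassicalNSSolutionOn S ν f u p) (hS : IsOpen S) {φ : E → ℝ} (hφ : Continuous φ)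
    (hφc : HasCompactSupport φ) :
    ContinuousOn (fun s => ∫ x, frobeniusNormSq (fderiv ℝ (u s) x) * φ x) S := by
  refine continuousOn_integral_of_support_subset (μ := volume) (K := tsupport φ) hφc ?_ ?_
  · have hu1 : ContDiffOn ℝ 1 (uncurry u) (S ×ˢ univ) := h.smooth_velocity.of_le (by norm_cast)
    have cDu : ContinuousOn (fun z : ℝ × E => fderiv ℝ (u z.1) z.2) (S ×ˢ univ) :=
      continuousOn_fderiv_slice_of_contDiffOn hu1 hS.uniqueDiffOn
    have c1 : ContinuousOn (fun z : ℝ × E => frobeniusNormSq (fderiv ℝ (u z.1) z.2)) (S ×ˢ univ) :=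
      LerayHopfProofs.continuous_frobeniusNormSq.comp_continuousOn cDu
    exact c1.mul (hφ.comp continuous_snd).continuousOn
  · intro s _ x hx
    show frobeniusNormSq (fderiv ℝ (u s) x) * φ x = 0
    rw [image_eq_zero_of_notMem_tsupport hx, mul_zero]

/-! ### The integrated identity -/

/-- **The local energy identity of a classical solution, integrated in time** (Chae–Wolf 2017,
(2.4f), for a time-independent cut-off; CKN (2.5) with equality). Let `(u, p)` be a classical
solution of the unforced Navier–Stokes system with viscosity `ν` on an open time set `S`,
`φ ∈ C_c^∞(E)`, and `t₀ ≤ t₁` with `[t₀, t₁] ⊆ S`. Then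
`∫ φ|u(t₁)|² − ∫ φ|u(t₀)|² + 2ν ∫_{t₀}^{t₁} ∫ |∇u|² φ = ∫_{t₀}^{t₁} ∫ (νΔφ |u|² + Dφ(u)|u|² + 2 p Dφ(u))`.
[cite: ChaeWolf2017RemovingDSS, §2 Step 2 (2.4f) (arXiv p. 5); CaffarelliKohnNirenberg1982 §2 (2.5)] -/
theorem IsClassicalNSSolutionOn.local_energy_identity_cutoff
    (h : IsClassicalNSSolutionOn S ν 0 u p) (hS : IsOpen S) {φ : E → ℝ} (hφ : ContDiff ℝ ∞ φ)
    (hφc : HasCompactSupport φ) {t₀ t₁ : ℝ} (ht₀₁ : t₀ ≤ t₁) (hI : Icc t₀ t₁ ⊆ S) :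
    (∫ x, φ x * ‖u t₁ x‖ ^ 2) - (∫ x, φ x * ‖u t₀ x‖ ^ 2) +
        2 * ν * ∫ s in t₀..t₁, ∫ x, frobeniusNormSq (fderiv ℝ (u s) x) * φ x =
      ∫ s in t₀..t₁, ∫ x, (ν * ((Δ φ) x * ‖u s x‖ ^ 2) +
        fderiv ℝ φ x (u s x) * ‖u s x‖ ^ 2 + 2 * (p s x * fderiv ℝ φ x (u s x))) := by
  have hφcont : Continuous φ := hφ.continuous
  -- the three continuous functions of time
  have cT := h.continuousOn_integral_cutoff_inner_timeDeriv hS hφcont hφc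
  have cF := h.continuousOn_integral_flux_cutoff hφ hφc
  have cG := h.continuousOn_integral_dissipation_cutoff hS hφcont hφc
  have hI' : uIcc t₀ t₁ ⊆ S := by rwa [uIcc_of_le ht₀₁]
  have iT : IntervalIntegrable (fun s => ∫ x, φ x * (2 * ⟪u s x, timeDerivWithin S u s x⟫))
      volume t₀ t₁ := (cT.mono hI').intervalIntegrable
  have iF : IntervalIntegrable (fun s => ∫ x, (ν * ((Δ φ) x * ‖u s x‖ ^ 2) +
      fderiv ℝ φ x (u s x) * ‖u s x‖ ^ 2 + 2 * (p s x * fderiv ℝ φ x (u s x)))) volume t₀ t₁ :=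
    (cF.mono hI').intervalIntegrable
  have iG : IntervalIntegrable (fun s => ∫ x, frobeniusNormSq (fderiv ℝ (u s) x) * φ x)
      volume t₀ t₁ := (cG.mono hI').intervalIntegrable
  -- fundamental theorem of calculus
  have hFTC := intervalIntegral.integral_eq_sub_of_hasDerivAt
    (fun s hs => h.hasDerivAt_integral_cutoff_norm_sq hS hφ hφc (hI' hs)) iT
  -- the slice balance inside the time integral
  have hslice : ∫ s in t₀..t₁, ∫ x, φ x * (2 * ⟪u s x, timeDerivWithin S u s x⟫) =
      (∫ s in t₀..t₁, ∫ x, (ν * ((Δ φ) x * ‖u s x‖ ^ 2) +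
        fderiv ℝ φ x (u s x) * ‖u s x‖ ^ 2 + 2 * (p s x * fderiv ℝ φ x (u s x)))) -
      2 * ν * ∫ s in t₀..t₁, ∫ x, frobeniusNormSq (fderiv ℝ (u s) x) * φ x := by
    rw [← intervalIntegral.integral_const_mul, ← intervalIntegral.integral_sub iF (iG.const_mul _)]
    refine intervalIntegral.integral_congr fun s hs => ?_
    have := h.integral_energy_flux_cutoff hS hφ hφc (hI' hs)
    linarith
  rw [hslice] at hFTC
  linarith

end Literature.Analysis.FluidPDE

end
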